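import Mathlib
import Summits.ResolutionOfSingularities.ResolutionOfSingularities.Theorems.AbhyankarShadowsSemivaluationShadowsHenselOverRuledShadowsRankOneHelpers2
import Summits.ResolutionOfSingularities.ResolutionOfSingularities.Theorems.AbhyankarShadowsSemivaluationShadowsMinimalSpecialisation
import Summits.ResolutionOfSingularities.ResolutionOfSingularities.Theorems.AbhyankarShadowsSemivaluationShadowsRankOneSaturation
import HarnessLib

/-!
# Hensel-generated top layers: saturation, minimal approximant, and the frame of `K₀(ρ', ζ)`
(helpers for `stub_henselOverRuledShadowsRankOne`, IV)

Support file for the registered stub `stub_henselOverRuledShadowsRankOne` of the crux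
`stmt-ResolutionOfSingularities-16757` (`Theses.AbhyankarShadows.SemivaluationShadows`, line
`birth`):

* `HenselShadows.exists_saturation_approximant` — packages `rankOneSaturation_of` (extension
  `V` of `ν` to an algebraically closed `M ⊇ K`, residues constants, values torsion over `ν t`,
  whence the archimedean axiom) with `exists_minimal_exact_specialisation_of_algebra` (an
  approximant `ρ'` of the transcendental `v`, ALGEBRAIC over `K₀`, exact on a prescribed finite
  set of polynomials and on all polynomials of degree `< deg ρ'`);
* `HenselShadows.exists_frame_poly` — the FRAME downstairs: a uniformising polynomial `g_π` of
  `K₀(ρ')` of small degree (`exists_uniformizing_polynomial`), whose value generates the values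
  of all of `K₀(ρ', ζ)` when `ζ` is a Hensel root over `V ∩ K₀(ρ')` congruent to a constant
  (`exists_mem_valuation_eq`: no ramification).

No named facts are used. [folklore]
-/

set_option linter.dupNamespace false

noncomputable section

open Polynomial Literature.AlgebraicGeometry.Resolution

namespace Summit.ResolutionOfSingularities.ResolutionOfSingularities.Theorems

namespace HenselShadows

/-- **Saturation and minimal approximant.** For `k` algebraically closed, `O ∋ k` rational of
rational rank one with `0 ≠ t ∈ K₀` of value `< 1`, `v` transcendental over the intermediate
field `K₀`, and an algebraically closed algebraic extension `M ⊇ K`: a valuation ring `V` of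
`M` with `V ∩ K = O`, rational residues and archimedean value group, and `ρ' ∈ M` integral over
`K₀` with `V(f(ρ')) = V(f(v))` for every `f` in the prescribed finite set `S₀` and for every
non-zero `f` of degree `< deg (minpoly K₀ ρ')`. [folklore] -/
theorem exists_saturation_approximant (k K M : Type) [Field k] [IsAlgClosed k] [Field K]
    [Algebra k K] [Field M] [IsAlgClosed M] [Algebra K M] [Algebra k M] [IsScalarTower k K M]
    [Algebra.IsAlgebraic K M] (O : ValuationSubring K) (hk : ∀ c : k, algebraMap k K c ∈ O)
    (hrat : ∀ x : K, x ∈ O → ∃ c : k, O.valuation (x - algebraMap k K c) < 1)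
    (hrr : Module.finrank ℤ (Additive (O.ValueGroup)ˣ) = 1) (K₀ : IntermediateField k K)
    (t v : K) (htK₀ : t ∈ K₀) (ht0 : t ≠ 0) (ht1 : O.valuation t < 1)
    (hv : Transcendental K₀ v) (S₀ : Finset K₀[X]) :
    ∃ (V : ValuationSubring M) (ρ' : M), V.comap (algebraMap K M) = O ∧
      (∀ u : M, V.valuation u = 1 →
        ∃ c : k, V.valuation (u - algebraMap K M (algebraMap k K c)) < 1) ∧
      (∀ B γ δ : ValuationSubring.ValueGroup V, γ < 1 → δ ≠ 0 →
        ∃ n : ℕ, B * γ ^ (n + 1) < δ) ∧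
      IsIntegral K₀ ρ' ∧
      (∀ f ∈ S₀, V.valuation (aeval ρ' f) = V.valuation (algebraMap K M (aeval v f))) ∧
      ∀ f : K₀[X], f ≠ 0 → f.natDegree < (minpoly K₀ ρ').natDegree →
        V.valuation (aeval ρ' f) = V.valuation (algebraMap K M (aeval v f)) := by
  classical
  obtain ⟨V, hVO, htors, hres, hd, -, -⟩ := rankOneSaturation_of (M := M) O hk hrat hrr t ht0 ht1
  have hιt1 : V.valuation (algebraMap K M t) < 1 := (hd t).mp ht1
  have hιt0 : V.valuation (algebraMap K M t) ≠ 0 :=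
    (Valuation.ne_zero_iff _).mpr ((_root_.map_ne_zero _).mpr ht0)
  have harchV : ∀ B γ δ : ValuationSubring.ValueGroup V, γ < 1 → δ ≠ 0 →
      ∃ n : ℕ, B * γ ^ (n + 1) < δ :=
    exists_mul_pow_lt hιt0 hιt1 fun γ hγ => by
      obtain ⟨z, rfl⟩ := V.valuation_surjective γ
      exact htors z fun h0 => hγ (by rw [h0, map_zero])
  let t₀ : K₀ := ⟨t, htK₀⟩
  have ht₀M : algebraMap K₀ M t₀ = algebraMap K M t := IsScalarTower.algebraMap_apply K₀ K M t₀
  have htors' : ∀ z : M, z ≠ 0 → ∃ N : ℕ, N ≠ 0 ∧ ∃ b : K₀,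
      V.valuation z ^ N = V.valuation (algebraMap K₀ M b) := by
    intro z hz
    obtain ⟨N, hN, n, hn⟩ := htors z hz
    exact ⟨N, hN, t₀ ^ n, by rw [map_zpow₀, map_zpow₀, ht₀M, hn]⟩
  have hres' : ∀ u : M, V.valuation u = 1 → ∃ b : K₀, V.valuation (u - algebraMap K₀ M b) < 1 := by
    intro u hu
    obtain ⟨c, hc⟩ := hres u hu
    refine ⟨algebraMap k K₀ c, ?_⟩
    rwa [← IsScalarTower.algebraMap_apply, IsScalarTower.algebraMap_apply k K M]
  have hvM : Transcendental K₀ (algebraMap K M v) :=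
    (transcendental_algebraMap_iff (algebraMap K M).injective).mpr hv
  obtain ⟨ρ', hρ'alg, hexS, hexdeg⟩ := exists_minimal_exact_specialisation_of_algebra (F₀ := K₀)
    (M := M) V.valuation htors' hres' hvM (S₀.filter (· ≠ 0))
    (fun f hf' => (Finset.mem_filter.mp hf').2)
  refine ⟨V, ρ', hVO, hres, harchV, hρ'alg.isIntegral, fun f hf' => ?_, fun f hf0 hdeg => ?_⟩
  · by_cases hf0 : f = 0
    · simp only [hf0, map_zero]
    · rw [hexS f (Finset.mem_filter.mpr ⟨hf', hf0⟩), aeval_algebraMap_apply]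
  · rw [hexdeg f hf0 hdeg, aeval_algebraMap_apply]

/-- **The frame of `K₀(ρ', ζ)`.** With `V ∩ K = O`, `ν` discrete on `K₀` (values powers of
`ν t`), `ρ'` integral over `K₀`, the value group archimedean, and `ζ ∈ V` a Hensel root of a
polynomial `P` with coefficients in `V ∩ K₀(ρ')`, congruent to a constant: there is a non-zero
`g_π ∈ K₀[X]` of degree `< deg ρ'` with `V(g_π(ρ')) < 1` such that every non-zero element of
`K₀(ρ', ζ)` has value `V(g_π(ρ'))^n`, `n ∈ ℤ` (`exists_uniformizing_polynomial` for `K₀(ρ')`,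
and no ramification in `K₀(ρ')(ζ)` by `exists_mem_valuation_eq`). [folklore] -/
theorem exists_frame_poly (k K M : Type) [Field k] [Field K] [Algebra k K] [Field M] [Algebra K M]
    [Algebra k M] [IsScalarTower k K M] (O : ValuationSubring K)
    (hk : ∀ c : k, algebraMap k K c ∈ O) (V : ValuationSubring M)
    (hVO : V.comap (algebraMap K M) = O) (K₀ : IntermediateField k K) (t : K) (htK₀ : t ∈ K₀)
    (ht0 : t ≠ 0) (ht1 : O.valuation t < 1)
    (hdisc : ∀ x : K, x ∈ K₀ → x ≠ 0 → ∃ m : ℤ, O.valuation x = O.valuation t ^ m)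
    (harch : ∀ B γ δ : ValuationSubring.ValueGroup V, γ < 1 → δ ≠ 0 →
      ∃ n : ℕ, B * γ ^ (n + 1) < δ)
    {ρ' : M} (hρ' : IsIntegral K₀ ρ') {P : M[X]} (hPV : ∀ n, P.coeff n ∈ V)
    (hPL : ∀ n, P.coeff n ∈ IntermediateField.adjoin K₀ {ρ'}) (hPmon : P.Monic) {ζ : M}
    (hζV : ζ ∈ V) (hroot : P.eval ζ = 0) (hder : V.valuation ((derivative P).eval ζ) = 1)
    {c : k} (hζc : V.valuation (ζ - algebraMap k M c) < 1) :
    ∃ gπ : K₀[X], gπ ≠ 0 ∧ gπ.natDegree < (minpoly K₀ ρ').natDegree ∧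
      V.valuation (aeval ρ' gπ) < 1 ∧
      ∀ w : M, w ∈ IntermediateField.adjoin K₀ {ρ', ζ} → w ≠ 0 →
        ∃ n : ℤ, V.valuation w = V.valuation (aeval ρ' gπ) ^ n := by
  have he : ∀ x x' : K, O.valuation x = O.valuation x' ↔
      V.valuation (algebraMap K M x) = V.valuation (algebraMap K M x') := fun x x' =>
    (valuation_map_eq_iff (algebraMap K M) hVO x x').symm
  have hK₀M : ∀ x : K₀, algebraMap K₀ M x = algebraMap K M (x : K) := fun x =>
    IsScalarTower.algebraMap_apply K₀ K M x
  let t₀ : K₀ := ⟨t, htK₀⟩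
  have ht₀0 : algebraMap K₀ M t₀ ≠ 0 := by
    rw [hK₀M, _root_.map_ne_zero]; exact ht0
  have ht₀1 : V.valuation (algebraMap K₀ M t₀) < 1 := by
    rw [hK₀M]; exact (valuation_map_lt_one_iff (algebraMap K M) hVO _).mpr ht1
  have hdiscV : ∀ x : K₀, x ≠ 0 → ∃ n : ℤ,
      V.valuation (algebraMap K₀ M x) = V.valuation (algebraMap K₀ M t₀) ^ n := by
    intro x hx
    obtain ⟨n, hn⟩ := hdisc x x.2 fun h0 => hx (Subtype.ext h0)
    refine ⟨n, ?_⟩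
    rw [hK₀M, hK₀M, ← map_zpow₀, ← map_zpow₀]
    exact (he _ _).mp (by rw [map_zpow₀]; exact hn)
  obtain ⟨gπ, hgπ0, hgπdeg, hπ1, hπ0, hL₀val⟩ :=
    exists_uniformizing_polynomial V t₀ ht₀0 ht₀1 hdiscV hρ'
  set L₀f : IntermediateField K₀ M := IntermediateField.adjoin K₀ {ρ'} with hL₀fdef
  have hcL₀ : algebraMap k M c ∈ L₀f.toSubfield := by
    rw [IsScalarTower.algebraMap_apply k K₀ M]; exact L₀f.algebraMap_mem _
  have hcV : algebraMap k M c ∈ V := by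
    have h := hk c
    rw [← hVO, ValuationSubring.mem_comap] at h
    rwa [IsScalarTower.algebraMap_apply k K M]
  have hζint : IsIntegral L₀f ζ := by
    obtain ⟨P₀, hP₀⟩ : ∃ P₀ : L₀f[X], P₀.map (algebraMap L₀f M) = P :=
      (mem_lifts P).mp ((lifts_iff_coeff_lifts P).mpr fun n => ⟨⟨P.coeff n, hPL n⟩, rfl⟩)
    refine ⟨P₀, monic_of_injective (algebraMap L₀f M).injective (by rw [hP₀]; exact hPmon), ?_⟩
    rw [← eval_map, hP₀]
    exact hroot
  refine ⟨gπ, hgπ0, hgπdeg, hπ1, fun w hw hw0 => ?_⟩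
  have hwM : w ∈ IntermediateField.adjoin L₀f {ζ} := by
    rw [← IntermediateField.mem_restrictScalars K₀, hL₀fdef,
      IntermediateField.adjoin_simple_adjoin_simple]
    exact hw
  rw [← IntermediateField.mem_toSubalgebra,
    IntermediateField.adjoin_simple_toSubalgebra_of_isAlgebraic hζint.isAlgebraic,
    Algebra.adjoin_singleton_eq_range_aeval] at hwM
  obtain ⟨q₀, hq₀⟩ := hwM
  have hqL₀ : ∀ n, (q₀.map (algebraMap L₀f M)).coeff n ∈ L₀f.toSubfield := fun n => by
    rw [coeff_map]; exact (q₀.coeff n).2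
  have hqw : (q₀.map (algebraMap L₀f M)).eval ζ = w := by rw [eval_map, ← aeval_def]; exact hq₀
  obtain ⟨w', hw'L₀, hw'⟩ := exists_mem_valuation_eq V L₀f.toSubfield harch hPV
    (fun n => hPL n) hζV hroot hder hcL₀ hcV hζc _ hqL₀ (by rw [hqw]; exact hw0)
  rw [hqw] at hw'
  have hw'0 : w' ≠ 0 := by
    intro h0
    rw [h0, map_zero, Valuation.zero_iff] at hw'
    exact hw0 hw'
  obtain ⟨n, hn⟩ := hL₀val w' hw'L₀ hw'0
  exact ⟨n, by rw [hw', hn]⟩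

end HenselShadows

end Summit.ResolutionOfSingularities.ResolutionOfSingularities.Theorems

end
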